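import Summits.QuantumAdvantage.QuantumAdvantage.Theses.CentralFactorial
import Literature.NumberTheory.GaussSums.MatthewsWeierstrassHecke

/-!
# Birth skeleton (BC3) for the crux `MatthewsQuarticSign` — route `CentralFactorial`
# "Matthews' sign of the quartic Gauss sum = (elliptic product formula) ∘ (sign of the half-product)"

Skeleton registrar `planner-skel-stmt-QuantumAdvantage-10305-0`, 2026-08-17 (route re-audit bin REPAIRABLE;
item stmt-QuantumAdvantage-10305, rank 2 of route-QuantumAdvantage-CentralFactorial).

TARGET (FIXED, concluded BY NAME): the route decl
`Summit.QuantumAdvantage.QuantumAdvantage.Theses.CentralFactorial.MatthewsQuarticSign` — Matthews' 1979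
theorem in the Ireland–Rosen p. 138 dress: for `p ≡ 1 (4)` prime, `p = a² + b²` with `π = a + bi` primary,
`r = -a/b` (the image of `i` in `ℤ[i]/π = ZMod p`), `χ` the quartic-residue cascade (`χ_π`), `β = ±i` read
off `((p-1)/2)! ≡ ±r`:  `G(χ_π) := Σ_{x<p} χ(x) e^{2πix/p} = -β · χ(2r) · (2|b| / |a|) · √((-1)^{(p-1)/4} (a+bi) √p)`
(principal square root, Jacobi symbol).

## Why this cut (and not "g² formula + sign bit")

The CLASSICAL HALF of the crux is already a tree THEOREM: `Literature.NumberTheory.GaussSums.quarticGaussSum_sq`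
(Ireland–Rosen Prop. 9.10.1, same binders) and `quarticGaussSum_eq_matthews_or_neg` (`LHS = RHS ∨ LHS = -RHS`)
in `Literature/NumberTheory/GaussSums/MatthewsQuarticSignProofs.lean`.  What remains is ONE BIT per `(p, π)`,
and its only known proof is Matthews' (Invent. Math. 54 (1979) 23–52): an ELLIPTIC PRODUCT FORMULA of
Cassels type (his Theorem 1; Berndt–Evans 1981 (4.7)) followed by the evaluation of the elliptic half-product
(his §§5–8 "Loxton's conjecture", Berndt–Evans (4.7) ⟹ (4.8), by modular forms: division values of `℘'` as
Hecke's weight-3 Eisenstein series of level `p`, eqs. (8.5)–(8.10) — the tree's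
`Literature.NumberTheory.GaussSums.HeckeEisenstein.derivWeierstrassP_gaussian_div_eq_smul` is (8.10)).
The statement of Matthews' product formula is quoted from Asai, *Elliptic Gauss sums and Hecke L-values at
s = 1* (arXiv:0707.3711), Part II §5.1, proof of Lemma 15 ("Formula ([M2], esp. p. 51)"):

  `G₄(π) = -β(π) · χ_π(2i) · ∏_{r ∈ N} T(θ r/π) · p^{1/4}`,  `N = {1, 2, …, (p-1)/2}`,

where `T(u) = -2℘₁(u)/℘₁'(u)` for the Weierstrass function `℘₁` of the lattice `θℤ[i]` with
`℘₁'² = 4℘₁³ - ℘₁`, `θ = √2·ϖ = 3.70814935…` (`ϖ = 2∫₀¹ dx/√(1-x⁴)` the lemniscate constant), and `β(π)` is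
determined by `β(π)² = -1`, `β(π) ≡ ∏_{r∈N} r = ((p-1)/2)! (mod π)` — i.e. EXACTLY the `β` of the crux, and
`χ_π(2i) = χ(2r)`.  By homogeneity (`℘_{θΛ}(θz) = θ⁻²℘_Λ(z)`, `℘'_{θΛ}(θz) = θ⁻³℘'_Λ(z)`), in terms of the
tree's Gaussian period pair `Λᵢ = (i, 1)` (lattice `ℤi + ℤ`, `PeriodPair.ofUpperHalfPlane UpperHalfPlane.I`):
`T(θu) = -2θ · ℘[Λᵢ](u) / ℘'[Λᵢ](u)` with `θ = Γ(1/4)²/(2√π)` (`matthewsT` below), and the half-product is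
`halfProduct p a b = ∏_{x=1}^{(p-1)/2} matthewsT (x/(a+bi))` (the points `x/(a+bi)`, `1 ≤ x ≤ (p-1)/2`, avoid the
half-lattice, so no factor degenerates).

## The two stubs (none is the crux, none is the summit)

* `stub_matthewsProductFormula` — MATTHEWS' PRODUCT FORMULA (his Theorem 1 / Berndt–Evans (4.7), in the
  binders of the crux): `G(χ) = -β · χ(2r) · (√p)^{1/2} · halfProduct p a b`.  This is where `β` enters
  (an elliptic "Gauss lemma": the half-system `N` contributes `∏_{r∈N} r ≡ β (mod π)`), via complex
  multiplication of the lemniscatic curve, the `π`-division field `ℚ(i)(sl(·/π))`, Stickelberger-type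
  congruences and Gauss's `ϖ' ≡ (-1)^M C(N,M) (mod ϖ)` (Matthews (2.11); proved in the tree:
  `Literature.NumberTheory.GaussSums.GaussBinomial.red_star_eq`).  β-dependence YES, Jacobi symbol NO.
  [Matthews1979Quartic Thm 1, §§2–7; Asai arXiv:0707.3711 §II.5.1 Lemma 15; BerndtEvans1981 §4.2 (4.7);
  Cassels 1970 (cubic analogue)]  Size: XL.
* `stub_halfProductSignLaw` — THE SIGN OF THE ELLIPTIC HALF-PRODUCT (Matthews §8 "Loxton's conjecture",
  Berndt–Evans (4.7) ⟹ (4.8)): `halfProduct p a b = (2|b| / |a|) · √((-1)^{(p-1)/4} (a + bi))` (principal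
  root).  The quartic analogue of Gauss's `∏_{r=1}^{(p-1)/2} 2 sin(2πr/p) = √p`; its square
  `halfProduct² = (-1)^{(p-1)/4} π` is the algebraic part (π-multiplication polynomial `U(0) = π` of
  `sl`, Asai §II.1.2 Example 5 / §II.3.2), the sign `(2|b|/|a|)` is the modular part (Hecke `G₃` of level
  `p`, Matthews (8.5)–(8.10)).  β-dependence NO, Jacobi symbol YES.  A foreseen glued split of this stub:
  `halfProduct² = (-1)^{(p-1)/4}(a+bi)` [L] + the half-plane statement [XL].
  [Matthews1979Quartic §8 pp. 43–51; Loxton1978 doi:10.1515/crll.1978.297.153; BerndtEvans1981 (4.8)–(4.10);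
  tree `MatthewsWeierstrassHecke.lean`]  Size: XL.

Both stubs were VERIFIED NUMERICALLY exactly as typed (planner folder `compute/matthews_product_check.py`:
`℘, ℘'` of `ℤi + ℤ` by the rapidly convergent `π²/sin²` lattice sums, sanity checks `℘(1/2) = ϖ₀²`,
`℘((1+i)/2) = 0`, `℘'(1/4) = -2√2(1+√2)ϖ₀³`, ODE residual `1e-12`): all 134 primary triples `(p, a, b)`
(both signs of `b`, negative `a` included), `p < 800` — product formula to `|Δ| < 2·10⁻¹¹`, half-product
sign law to `|Δ| < 2·10⁻¹¹`, 0 failures.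

COMPOSITION `MatthewsQuarticSign_of : Goal.stub_matthewsProductFormula → Goal.stub_halfProductSignLaw →
MatthewsQuarticSign` (kernel-checked, no `sorry` of its own): substitute the sign law into the product
formula and merge the principal roots, `X^{1/2} · (√p)^{1/2} = (X · √p)^{1/2}` for the non-negative real
`√p` (`mul_ofReal_cpow`, proved here) — which is `p^{1/4} √((-1)^k π) = √((-1)^k π √p)`.

Disproof used: none exists (`ledger crux ls stmt-QuantumAdvantage-10305`: no workfiles, no `Disproof.lean`,
no `Negative/` lemmas at registration).  Negatives index (`ledger negatives --problem QuantumAdvantage`,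
2026-08-17: 6 refuted statements — RegulatorThird, ShorLocallyDark, CubicForrelation/CubicStability,
SpinorFlattening, KummerSector KsNotFrobenian, SeparableFrames): none concerns Gauss sums of order 4 or
elliptic functions, so neither stub restates a refuted statement.  BC3 probes (planner folder
`bc/MatthewsQuarticSign_probes.lean`, statements inlined WITHOUT the stubs/composition, farm rc 1):
`stubᵢ → MatthewsQuarticSign` and `stubᵢ → QuantumAdvantage` by `first | exact? | simpa | aesop` FAIL for
both stubs (4/4: `exact?`/`simpa` fail, aesop "failed to prove the goal after exhaustive search", goals
`⊢ MatthewsQuarticSign` / `⊢ QuantumAdvantage` left unsolved); `bc/MatthewsQuarticSign_probes2.lean` (rc 1):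
`example : stubᵢ := by exact?` FAILS for both (no stub is a known theorem of the cone), `stub₁ → stub₂` and
`stub₂ → stub₁` FAIL (independent halves), and the converses `MatthewsQuarticSign → stubᵢ` FAIL too
(heartbeat timeout / aesop exhausted).  `#print axioms MatthewsQuarticSign_of`: propext, Classical.choice,
Quot.sound (no `sorryAx`).

Imports: the route file and `Literature.NumberTheory.GaussSums.MatthewsWeierstrassHecke` (Matthews §8 in the
tree; it brings `PeriodPair.ofUpperHalfPlane` and Mathlib's `℘`, `℘'`).
-/

set_option linter.dupNamespace false

noncomputable section

namespace Summit.QuantumAdvantage.QuantumAdvantage.Cruxes.MatthewsQuarticSign.Birth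

open scoped Classical
open Complex PeriodPair
open Summit.QuantumAdvantage.QuantumAdvantage.Theses.CentralFactorial

/-! ## Matthews' `T`-function and the elliptic half-product -/

/-- **Matthews' `T(θu)`** on the Gaussian lattice `ℤi + ℤ`: `T(θu) = -2θ · ℘(u)/℘'(u)` with
`θ = Γ(1/4)²/(2√π) = 3.70814935…` (for Matthews' own lattice `θℤ[i]`, `℘₁'² = 4℘₁³ - ℘₁`, this is
`T(v) = -2℘₁(v)/℘₁'(v)` at `v = θu`; equivalently `T(θu) = ζ₈ · sl((1-i)ϖu)`, Asai §II.5.1).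
[cite: Matthews1979Quartic, §8 and p. 51] [cite: arXiv:0707.3711, Part II §5.1 proof of Lemma 15] -/
def matthewsT (u : ℂ) : ℂ :=
  -2 * ((Real.Gamma (1 / 4) ^ 2 / (2 * Real.sqrt Real.pi) : ℝ) : ℂ) *
    (℘[PeriodPair.ofUpperHalfPlane UpperHalfPlane.I] u / ℘'[PeriodPair.ofUpperHalfPlane UpperHalfPlane.I] u)

/-- **The elliptic half-product** `∏_{x=1}^{(p-1)/2} T(θ x/π)`, `π = a + bi`, over the half-system
`N = {1, …, (p-1)/2}` of Matthews' formula. [cite: Matthews1979Quartic, p. 51]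
[cite: arXiv:0707.3711, Part II §5.1] -/
def halfProduct (p : ℕ) (a b : ℤ) : ℂ :=
  ∏ x ∈ Finset.Icc 1 ((p - 1) / 2), matthewsT ((x : ℂ) / ((a : ℂ) + (b : ℂ) * Complex.I))

/-! ## Statements under the stub names
(the skeleton audit keys the hypotheses of `MatthewsQuarticSign_of` by the head name of their types). -/
namespace Goal

/-- Statement of `stub_matthewsProductFormula`: **Matthews' product formula** (Theorem 1 of Matthews 1979 in
the binders of the crux; Berndt–Evans 1981 (4.7)): for `p ≡ 1 (4)` prime, `a² + b² = p` with `a + bi`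
primary, `r = -a/b`, `χ` the quartic-residue cascade and `β = ±i` from `((p-1)/2)! ≡ ±r`,
`Σ_{x<p} χ(x) e^{2πix/p} = -β · χ(2r) · (√p)^{1/2} · ∏_{x=1}^{(p-1)/2} T(θx/(a+bi))`. -/
abbrev stub_matthewsProductFormula : Prop :=
  ∀ (p : ℕ) (a b : ℤ) (r : ZMod p) (χ : ZMod p → ℂ) (β : ℂ), p.Prime → p % 4 = 1 →
    a ^ 2 + b ^ 2 = (p : ℤ) → ((a % 4 = 1 ∧ b % 4 = 0) ∨ (a % 4 = 3 ∧ b % 4 = 2)) →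
    r = -(a : ZMod p) * (b : ZMod p)⁻¹ →
    χ = (fun x => if x = 0 then 0 else if x ^ ((p - 1) / 4) = 1 then 1
      else if x ^ ((p - 1) / 4) = r then Complex.I else if x ^ ((p - 1) / 4) = -1 then -1
      else -Complex.I) →
    β = (if ((Nat.factorial ((p - 1) / 2) : ℕ) : ZMod p) = r then Complex.I else -Complex.I) →
    ∑ x ∈ Finset.range p, χ (x : ZMod p) * Complex.exp (2 * Real.pi * Complex.I * (x : ℂ) / (p : ℂ)) =
      -β * χ (2 * r) * ((Real.sqrt p : ℝ) : ℂ) ^ ((1 : ℂ) / 2) * halfProduct p a b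

/-- Statement of `stub_halfProductSignLaw`: **the sign of the elliptic half-product** (Matthews 1979 §8,
"Loxton's conjecture"; Berndt–Evans (4.7) ⟹ (4.8)): for `p ≡ 1 (4)` prime and `a² + b² = p` with
`a + bi` primary, `∏_{x=1}^{(p-1)/2} T(θx/(a+bi)) = (2|b| / |a|) · √((-1)^{(p-1)/4} (a + bi))` with the
principal square root and the Jacobi symbol. -/
abbrev stub_halfProductSignLaw : Prop :=
  ∀ (p : ℕ) (a b : ℤ), p.Prime → p % 4 = 1 → a ^ 2 + b ^ 2 = (p : ℤ) →
    ((a % 4 = 1 ∧ b % 4 = 0) ∨ (a % 4 = 3 ∧ b % 4 = 2)) →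
    halfProduct p a b = ((jacobiSym (2 * |b|) a.natAbs : ℤ) : ℂ) *
      ((-1 : ℂ) ^ ((p - 1) / 4) * ((a : ℂ) + (b : ℂ) * Complex.I)) ^ ((1 : ℂ) / 2)

end Goal

/-! ## The two stubs (the ONLY `sorry`s of this file) -/

/-- STUB 1 (XL): MATTHEWS' PRODUCT FORMULA for the quartic Gauss sum (statement `Goal.stub_matthewsProductFormula`).
Proof plan: complex multiplication on the lemniscatic curve, the `π`-division field generated by
`sl(1/π)` (Asai §II.1.2 Lemma 7, Example 5: `U(0) = π`), the canonical quartic root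
`π̃ = γ(S)⁻¹ ∏_{ν∈S} φ(ν/π)` (`π̃⁴ = -π`, `γ(S) ≡ ∏_{ν∈S} ν`), and Matthews' congruences §§2–7 incl. (2.11)
(tree: `GaussBinomial.red_star_eq`); equivalently Asai's `G₄(π) = χ_π(-2) π̃³ conj(π̃)` (Lemma 15).
[cite: Matthews1979Quartic, Thm 1 and p. 51] [cite: arXiv:0707.3711, Part II Lemma 15]
[cite: BerndtEvans1981, §4.2 (4.7)] -/
theorem stub_matthewsProductFormula : Goal.stub_matthewsProductFormula := by
  sorry

/-- STUB 2 (XL): THE SIGN LAW OF THE ELLIPTIC HALF-PRODUCT (statement `Goal.stub_halfProductSignLaw`).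
Proof plan: the square `halfProduct² = (-1)^{(p-1)/4} (a + bi)` from the `π`-multiplication formula
(`∏_{ν mod π}' φ(ν/π) = π`, `φ(iu) = iφ(u)`, `T = ζ₈ φ`); the sign from Matthews §8: `T = -2℘₁/℘₁'`, the
division values `℘'(r/π)` as values of Hecke's `G₃(τ; 0, r; p)` at `γ·i` (tree:
`HeckeEisenstein.derivWeierstrassP_gaussian_div_eq_smul` = Matthews (8.10)), then the modular computation
of pp. 44–51 producing the Jacobi symbol `(2|b|/|a|)`.
[cite: Matthews1979Quartic, §8 (8.5)–(8.10), pp. 43–51] [cite: BerndtEvans1981, §4.2 (4.8)–(4.10)]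
[cite: Loxton1978, doi:10.1515/crll.1978.297.153] -/
theorem stub_halfProductSignLaw : Goal.stub_halfProductSignLaw := by
  sorry

/-! ## Kernel-checked composition -/

/-- Principal powers are multiplicative against a non-negative REAL factor:
`(X · c)^s = X^s · c^s` for `c ≥ 0` (the argument of `X · c` is that of `X`). [folklore] -/
theorem mul_ofReal_cpow (X : ℂ) {c : ℝ} (hc : 0 ≤ c) (s : ℂ) :
    (X * (c : ℂ)) ^ s = X ^ s * (c : ℂ) ^ s := by
  rcases eq_or_ne s 0 with (rfl | hs)
  · simp only [cpow_zero, mul_one]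
  rcases eq_or_lt_of_le hc with (rfl | hc')
  · rw [ofReal_zero, mul_zero, zero_cpow hs, mul_zero]
  rcases eq_or_ne X 0 with (rfl | hX)
  · rw [zero_mul, zero_cpow hs, zero_mul]
  have hc'' : (c : ℂ) ≠ 0 := ofReal_ne_zero.mpr hc'.ne'
  rw [cpow_def_of_ne_zero (mul_ne_zero hX hc''), log_mul_ofReal c hc' X hX, ofReal_log hc,
    add_mul, exp_add, ← cpow_def_of_ne_zero hX, ← cpow_def_of_ne_zero hc'', mul_comm]

/-- COMPOSITION (real proof, no `sorry`): Matthews' product formula and the sign law of the elliptic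
half-product give the crux `MatthewsQuarticSign` BY NAME — substitute and merge the principal roots,
`√((-1)^k π) · (√p)^{1/2} = √((-1)^k π √p)`. -/
theorem MatthewsQuarticSign_of (h₁ : Goal.stub_matthewsProductFormula)
    (h₂ : Goal.stub_halfProductSignLaw) : MatthewsQuarticSign := by
  intro p a b r χ β hp hp4 hab hprim hr hχ hβ
  refine (h₁ p a b r χ β hp hp4 hab hprim hr hχ hβ).trans ?_
  rw [h₂ p a b hp hp4 hab hprim,
    mul_ofReal_cpow ((-1 : ℂ) ^ ((p - 1) / 4) * ((a : ℂ) + (b : ℂ) * Complex.I))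
      (Real.sqrt_nonneg _) ((1 : ℂ) / 2)]
  ring

end Summit.QuantumAdvantage.QuantumAdvantage.Cruxes.MatthewsQuarticSign.Birth
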